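/-
HONEST FRAMING: systematic search; no irrationality claim unless certified.
-/
import Summits.KontsevichZagierPeriods.Zeta5Search.WedgeDictionaryGhostRay
import HarnessLib

/-!
# The whole `{1,6}` two-top face of `explicitPQ` from the ghost datum (PROVED reduction)

D2 lane, gen-1 g16 (planner-pub-zeta5-gen-1-g16-0), 2026-08-21; sequel of `WedgeDictionaryGhostRay` (memo
`pub-zeta5-gen-1/D2-INDUCTION-g16.md` §3.12).

## What is proved

The `{1,6}` TWO-TOP FACE of the region of `explicitPQ` is the set of region points `a` whose dual point `b = b(a)` has
`b₆ = b₁` and `2b₁ = b₀ + 1` (odd level `N = b₀`, the two non-edge slots `1, 6` at the top value `(N+1)/2`; the fifteen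
convergence forms `N − b_i − b_j ≥ 0` over the EDGES then force `b_k ≤ (N−1)/2` for `k = 2,3,4,5,7`).  This face is
one half of the "ghost class" of the memo (§1, §3.3: odd `N`, top pair `{1,6}` or `{4,6}`), which the frame + standard
charts of the contiguity induction do not determine.  We prove (`explicitPQAt_twoTop16`):

  under the four relation families `CellStar`, `DictStar`, `CellPencil`, `DictPencil` of `WedgeDictionaryThreeTerm`
  (conjectural tree statements, hypotheses here), `explicitPQ` at the single ghost datum `G_0 = (0,0,1,0,1,0,0,1)`
  implies `explicitPQ` (partner index `2`) at EVERY point of the `{1,6}` two-top face.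

Mechanism: on the face the fan coefficient `χ₁Π₁(b) = (b₀+1−b₁−b₆)(b₀+1−b₁−b₇)` vanishes (`fanCoeff_one_of_twoTop16`),
so every STAR(1,k), `k ∈ {2,3,4,5,7}`, is a TWO-term relation `κ·I(a) = χ_kΠ_k·I(a − s_k)` with
`κ = (b₁−b_k)(b₀+1−b₁−b_k) = (t−b_k)² ≠ 0`; induction on `b₂+b₃+b₄+b₅+b₇` inside the face (the region is closed under
the slot-down moves, `regionHyp_slotDown`) reduces every face point to the ray point `G_n` of its level, and
`explicitPQAt_ghost_ray` reduces the ray to the datum.  So the `{1,6}` ghost component costs exactly ONE datum.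

What this file is NOT: a proof of any STAR/PENCIL instance, of the datum, of the `{4,6}` component (an `S₇`-image;
not treated here), or of anything about irrationality.
-/

noncomputable section

open Finset

namespace Summit.KontsevichZagierPeriods.Zeta5Search.WedgeDictionary

open Literature.NumberTheory.Irrationality.BrownZudilin2022 (bOfA Converges convergenceForms cellularIntegral QOf)
open Literature.NumberTheory.Transcendental (zetaValue)

/-! ## 1. The first-point form of the 2-of-3 step -/

/-- **2-of-3, first point, degenerate third coefficient.** A three-term relation with `γ = 0`, `α ≠ 0` transfers
`explicitPQ` from the second point back to the first. [folklore] -/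
theorem at_of_threeTerm_first {α β γ : ℚ} {a₀ a₁ a₂ : Fin 8 → ℤ} {j₀ j₁ j₂ : ℕ}
    (hrel : ThreeTermRel α β γ a₀ a₁ a₂) (hd : DictThreeTerm α β γ a₀ a₁ a₂ j₀ j₁ j₂) (h₁ : ExplicitPQAt a₁ j₁)
    (hα : α ≠ 0) (hγ : γ = 0) : ExplicitPQAt a₀ j₀ := by
  obtain ⟨hq, hph, hp⟩ := hd
  have hq' : (α : ℝ) * (QOf a₀ : ℝ) + (β : ℝ) * (QOf a₁ : ℝ) + (γ : ℝ) * (QOf a₂ : ℝ) = 0 := by exact_mod_cast hq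
  have hph' : (α : ℝ) * (dictPhat a₀ j₀ : ℝ) + (β : ℝ) * (dictPhat a₁ j₁ : ℝ) + (γ : ℝ) * (dictPhat a₂ j₂ : ℝ) = 0 := by
    exact_mod_cast hph
  have hp' : (α : ℝ) * (dictP a₀ j₀ : ℝ) + (β : ℝ) * (dictP a₁ j₁ : ℝ) + (γ : ℝ) * (dictP a₂ j₂ : ℝ) = 0 := by
    exact_mod_cast hp
  have hα' : (α : ℝ) ≠ 0 := by exact_mod_cast hα
  have hγ' : (γ : ℝ) = 0 := by exact_mod_cast hγ
  unfold ThreeTermRel at hrel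
  unfold ExplicitPQAt at h₁ ⊢
  rw [h₁] at hrel
  have key : (α : ℝ) * (cellularIntegral a₀ - ((QOf a₀ : ℝ) * (2 * zetaValue 5 + 4 * zetaValue 3 * zetaValue 2) -
      4 * (dictPhat a₀ j₀ : ℝ) * zetaValue 2 - 2 * (dictP a₀ j₀ : ℝ))) = 0 := by
    linear_combination hrel - (2 * zetaValue 5 + 4 * zetaValue 3 * zetaValue 2) * hq' + 4 * zetaValue 2 * hph' +
      2 * hp' - (cellularIntegral a₂ - ((QOf a₂ : ℝ) * (2 * zetaValue 5 + 4 * zetaValue 3 * zetaValue 2) -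
      4 * (dictPhat a₂ j₂ : ℝ) * zetaValue 2 - 2 * (dictP a₂ j₂ : ℝ))) * hγ'
  rcases mul_eq_zero.1 key with h | h
  · exact absurd h hα'
  · linarith

/-- **Degenerate STAR transfer, upward (`a − s_k ↦ a`).** If `χ_iΠ_i(b(a)) = 0` and `κ = (b_i−b_k)(b₀+1−b_i−b_k) ≠ 0`,
the STAR(`i`,`k`) relations at `a` transfer `explicitPQ` from `a − s_k` to `a`. [folklore] -/
theorem at_star_first (hc : CellStar) (hd : DictStar) {a : Fin 8 → ℤ} {i k j₀ j₁ j₂ : ℕ} (hi : i ∈ Icc 1 7)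
    (hk : k ∈ Icc 1 7) (hik : i ≠ k) (r₀ : RegionHyp a j₀) (r₁ : RegionHyp (a + slotDown k) j₁)
    (r₂ : RegionHyp (a + slotDown i) j₂) (h₁ : ExplicitPQAt (a + slotDown k) j₁)
    (hα : starKappa (bOfA a) i k ≠ 0) (hγ : fanCoeff (bOfA a) i = 0) : ExplicitPQAt a j₀ := by
  have hrel := hc a i k j₀ j₁ j₂ hi hk hik r₀ r₁ r₂
  have hdic := hd a i k j₀ j₁ j₂ hi hk hik r₀ r₁ r₂
  have hα' : (starKappa (bOfA a) i k : ℚ) ≠ 0 := by exact_mod_cast hα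
  have hγ' : (fanCoeff (bOfA a) i : ℚ) = 0 := by exact_mod_cast hγ
  exact at_of_threeTerm_first hrel hdic h₁ hα' hγ'

/-! ## 2. The region is closed under slot-down moves -/

/-- The seventeen convergence forms as named inequalities. -/
theorem forms_of_converges {a : Fin 8 → ℤ} (hc : Converges a) :
    0 ≤ a 0 ∧ 0 ≤ a 1 ∧ 0 ≤ a 2 ∧ 0 ≤ a 3 ∧ 0 ≤ a 4 ∧ 0 ≤ a 5 ∧ 0 ≤ a 6 ∧ 0 ≤ a 0 + a 4 - a 2 ∧
      0 ≤ a 2 + a 5 - a 7 ∧ 0 ≤ a 3 + a 4 + a 6 + a 7 - a 1 - a 2 - a 5 ∧ 0 ≤ a 6 + a 7 - a 5 ∧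
        0 ≤ a 3 + a 7 - a 1 ∧ 0 ≤ a 1 + a 2 + a 5 - a 3 - a 7 ∧ 0 ≤ a 0 + a 7 - a 2 ∧ 0 ≤ a 0 + a 1 - a 3 ∧
          0 ≤ a 3 + a 4 - a 1 ∧ 0 ≤ a 3 + a 6 + 2 * a 7 - a 1 - a 2 - a 5 := by
  refine ⟨hc _ ?_, hc _ ?_, hc _ ?_, hc _ ?_, hc _ ?_, hc _ ?_, hc _ ?_, hc _ ?_, hc _ ?_, hc _ ?_, hc _ ?_, hc _ ?_,
    hc _ ?_, hc _ ?_, hc _ ?_, hc _ ?_, hc _ ?_⟩ <;> simp [convergenceForms]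

/-- Conversely the seventeen inequalities give `Converges`. -/
theorem converges_of_forms {a : Fin 8 → ℤ}
    (h : 0 ≤ a 0 ∧ 0 ≤ a 1 ∧ 0 ≤ a 2 ∧ 0 ≤ a 3 ∧ 0 ≤ a 4 ∧ 0 ≤ a 5 ∧ 0 ≤ a 6 ∧ 0 ≤ a 0 + a 4 - a 2 ∧
      0 ≤ a 2 + a 5 - a 7 ∧ 0 ≤ a 3 + a 4 + a 6 + a 7 - a 1 - a 2 - a 5 ∧ 0 ≤ a 6 + a 7 - a 5 ∧
        0 ≤ a 3 + a 7 - a 1 ∧ 0 ≤ a 1 + a 2 + a 5 - a 3 - a 7 ∧ 0 ≤ a 0 + a 7 - a 2 ∧ 0 ≤ a 0 + a 1 - a 3 ∧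
          0 ≤ a 3 + a 4 - a 1 ∧ 0 ≤ a 3 + a 6 + 2 * a 7 - a 1 - a 2 - a 5) : Converges a := by
  intro x hx
  simp [convergenceForms] at hx
  omega

/-- `d` goes up by one under a slot-down move. -/
theorem dOf_bOfA_slotDown (a : Fin 8 → ℤ) {k : ℕ} (hk : k ∈ Icc 1 7) :
    dOf (bOfA (a + slotDown k)) = dOf (bOfA a) + 1 := by
  simp only [mem_Icc] at hk
  obtain ⟨h1, h7⟩ := hk
  interval_cases k <;> simp [dOf, Finset.sum_range_succ, bOfA, slotDown] <;> ring1

/-- **The region is closed under `a ↦ a − s_k` whenever `b_k ≥ 1`** (same partner index): the convergence forms are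
`b₂, b₃` and `N − b_i − b_j` over the fifteen edges, all non-decreasing; the box and `d ≥ 0` persist. [folklore] -/
theorem regionHyp_slotDown {a : Fin 8 → ℤ} {j k : ℕ} (hr : RegionHyp a j) (hk : k ∈ Icc 1 7)
    (hpos : 1 ≤ bOfA a k) : RegionHyp (a + slotDown k) j := by
  obtain ⟨hj, hconv, hbox, hd, hpart⟩ := hr
  have hF := forms_of_converges hconv
  have hj7 : j ≤ 7 := (mem_Icc.1 hj).2
  refine ⟨hj, ?_, ?_, ?_, ?_⟩
  · apply converges_of_forms
    have hk' := hk
    simp only [mem_Icc] at hk'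
    obtain ⟨h1, h7⟩ := hk'
    interval_cases k <;> simp [slotDown, bOfA] at hpos ⊢ <;> omega
  · intro i hi
    have hi7 : i ≤ 7 := (mem_Icc.1 hi).2
    have hb := hbox i hi
    have hk1 : 1 ≤ k := (mem_Icc.1 hk).1
    have hk0 : (0 : ℕ) ≠ k := by omega
    rw [bOfA_add_slotDown a k hk i hi7, bOfA_add_slotDown a k hk 0 (by norm_num), if_neg hk0]
    by_cases hik : i = k
    · subst hik
      rw [if_pos rfl]
      omega
    · rw [if_neg hik]
      omega
  · rw [dOf_bOfA_slotDown a hk]; omega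
  · have hk1 : 1 ≤ k := (mem_Icc.1 hk).1
    rw [bOfA_add_slotDown a k hk j hj7, bOfA_add_slotDown a k hk 0 (by norm_num)]
    split_ifs <;> omega

/-! ## 3. The `{1,6}` two-top face -/

/-- The `{1,6}` two-top face: `b₆ = b₁` and `2b₁ = b₀ + 1`. -/
def TwoTop16 (a : Fin 8 → ℤ) : Prop := bOfA a 6 = bOfA a 1 ∧ 2 * bOfA a 1 = bOfA a 0 + 1

/-- On the face the fan coefficient of slot `1` vanishes: `χ₁Π₁ = (b₀+1−b₁−b₆)(b₀+1−b₁−b₇) = 0`. -/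
theorem fanCoeff_one_of_twoTop16 {a : Fin 8 → ℤ} (hf : TwoTop16 a) : fanCoeff (bOfA a) 1 = 0 := by
  obtain ⟨h6, h1⟩ := hf
  have hz : bOfA a 0 + 1 - bOfA a 1 - bOfA a 6 = 0 := by omega
  simp [fanCoeff, chiOf, nonEdgePartners, hz]

/-- The face is closed under the slot-down moves in the slots `2,3,4,5,7`. -/
theorem twoTop16_slotDown {a : Fin 8 → ℤ} (hf : TwoTop16 a) {k : ℕ} (hk : k ∈ Icc 1 7) (hk1 : k ≠ 1) (hk6 : k ≠ 6) :
    TwoTop16 (a + slotDown k) := by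
  obtain ⟨h6, h1⟩ := hf
  refine ⟨?_, ?_⟩
  · rw [bOfA_add_slotDown a k hk 6 (by norm_num), bOfA_add_slotDown a k hk 1 (by norm_num)]
    simp [Ne.symm hk1, Ne.symm hk6, h6]
  · have hk0 : (0 : ℕ) ≠ k := by have := (mem_Icc.1 hk).1; omega
    rw [bOfA_add_slotDown a k hk 1 (by norm_num), bOfA_add_slotDown a k hk 0 (by norm_num)]
    simp [Ne.symm hk1, hk0, h1]

/-- A face point with `b₂ = b₃ = b₄ = b₅ = b₇ = 0` is the ray point `G_n`, `n = a₀`. -/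
theorem eq_ghostA_of_twoTop16 {a : Fin 8 → ℤ} (hf : TwoTop16 a) (hconv : Converges a)
    (hz : bOfA a 2 = 0 ∧ bOfA a 3 = 0 ∧ bOfA a 4 = 0 ∧ bOfA a 5 = 0 ∧ bOfA a 7 = 0) :
    a = ghostA (a 0).toNat := by
  obtain ⟨h6, h1⟩ := hf
  obtain ⟨z2, z3, z4, z5, z7⟩ := hz
  have hF := forms_of_converges hconv
  have hn : ((a 0).toNat : ℤ) = a 0 := Int.toNat_of_nonneg hF.1
  simp only [bOfA] at h6 h1 z2 z3 z4 z5 z7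
  ext i
  fin_cases i <;> simp [ghostA, hn] <;> omega

/-- **THE `{1,6}` TWO-TOP FACE FROM ONE DATUM (PROVED).** Under the four relation families, `explicitPQ` at the ghost
datum `(0,0,1,0,1,0,0,1)` implies `explicitPQ` (partner `2`) at every region point of the `{1,6}` two-top face.
Induction on `b₂+b₃+b₄+b₅+b₇` by the degenerate STARs `(1,k)`, then `explicitPQAt_ghost_ray`. [folklore] -/
theorem explicitPQAt_twoTop16 (hcS : CellStar) (hdS : DictStar) (hcP : CellPencil) (hdP : DictPencil)
    (h0 : ExplicitPQAt ![0, 0, 1, 0, 1, 0, 0, 1] 2) :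
    ∀ a : Fin 8 → ℤ, RegionHyp a 2 → TwoTop16 a → ExplicitPQAt a 2 := by
  suffices H : ∀ s : ℕ, ∀ a : Fin 8 → ℤ, RegionHyp a 2 → TwoTop16 a →
      (bOfA a 2 + bOfA a 3 + bOfA a 4 + bOfA a 5 + bOfA a 7).toNat = s → ExplicitPQAt a 2 from
    fun a hr hf => H _ a hr hf rfl
  intro s
  induction s using Nat.strong_induction_on with
  | _ s ih =>
    intro a hr hf hs
    have hr' := hr
    obtain ⟨hj, hconv, hbox, hd, hpart⟩ := hr'
    have hF := forms_of_converges hconv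
    have hb1 := hbox 1 (by simp)
    have hb2 := hbox 2 (by simp)
    have hb3 := hbox 3 (by simp)
    have hb4 := hbox 4 (by simp)
    have hb5 := hbox 5 (by simp)
    have hb7 := hbox 7 (by simp)
    have hf' := hf
    obtain ⟨h6, h1⟩ := hf'
    by_cases hz : bOfA a 2 = 0 ∧ bOfA a 3 = 0 ∧ bOfA a 4 = 0 ∧ bOfA a 5 = 0 ∧ bOfA a 7 = 0
    · rw [eq_ghostA_of_twoTop16 hf hconv hz]
      exact explicitPQAt_ghost_ray hcS hdS hcP hdP h0 _
    · -- a slot `k ∈ {2,3,4,5,7}` with `b_k ≥ 1`: STAR(1,k) at `a` is two-term and lifts from `a − s_k`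
      have hγ := fanCoeff_one_of_twoTop16 hf
      have one7 : (1 : ℕ) ∈ Icc 1 7 := by simp
      have hpos1 : 1 ≤ bOfA a 1 := by simp only [bOfA] at h1 hb1 ⊢; omega
      have r₂ : RegionHyp (a + slotDown 1) 2 := regionHyp_slotDown hr one7 hpos1
      -- the generic step for a slot `k`
      have step : ∀ k : ℕ, k ∈ Icc 1 7 → k ≠ 1 → k ≠ 6 → 1 ≤ bOfA a k →
          starKappa (bOfA a) 1 k ≠ 0 → ExplicitPQAt a 2 := by
        intro k hk hk1 hk6 hposk hκ
        have r₁ : RegionHyp (a + slotDown k) 2 := regionHyp_slotDown hr hk hposk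
        have hf₁ : TwoTop16 (a + slotDown k) := twoTop16_slotDown hf hk hk1 hk6
        have hlt : (bOfA (a + slotDown k) 2 + bOfA (a + slotDown k) 3 + bOfA (a + slotDown k) 4 +
            bOfA (a + slotDown k) 5 + bOfA (a + slotDown k) 7).toNat < s := by
          have hk' := hk
          simp only [mem_Icc] at hk'
          obtain ⟨hk1', hk7'⟩ := hk'
          interval_cases k <;> simp [bOfA, slotDown] at hposk hb2 hb3 hb4 hb5 hb7 hs ⊢ <;> omega
        have ih₁ := ih _ hlt (a + slotDown k) r₁ hf₁ rfl
        exact at_star_first hcS hdS one7 hk (Ne.symm hk1) hr r₁ r₂ ih₁ hκ hγ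
      -- `κ(1,k) = (b₁−b_k)(b₀+1−b₁−b_k) ≠ 0` on the face because `b_k ≤ (N−1)/2 < b₁` (edge forms `N−b₁−b_k ≥ 0`
      -- for `k = 2,3,4,5`, and `N−b₆−b₇ ≥ 0` for `k = 7`)
      have hκ : ∀ k : ℕ, k ∈ Icc 1 7 → k ≠ 1 → k ≠ 6 → starKappa (bOfA a) 1 k ≠ 0 := by
        intro k hk hk1 hk6
        have hk' := hk
        simp only [mem_Icc] at hk'
        obtain ⟨hk1', hk7'⟩ := hk'
        interval_cases k <;> simp only [starKappa, bOfA] at h1 h6 ⊢ <;> first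
          | exact absurd rfl hk1 | exact absurd rfl hk6
          | exact mul_ne_zero (by omega) (by omega)
      have hsome : 1 ≤ bOfA a 2 ∨ 1 ≤ bOfA a 3 ∨ 1 ≤ bOfA a 4 ∨ 1 ≤ bOfA a 5 ∨ 1 ≤ bOfA a 7 := by omega
      rcases hsome with h | h | h | h | h
      · exact step 2 (by simp) (by decide) (by decide) h (hκ 2 (by simp) (by decide) (by decide))
      · exact step 3 (by simp) (by decide) (by decide) h (hκ 3 (by simp) (by decide) (by decide))
      · exact step 4 (by simp) (by decide) (by decide) h (hκ 4 (by simp) (by decide) (by decide))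
      · exact step 5 (by simp) (by decide) (by decide) h (hκ 5 (by simp) (by decide) (by decide))
      · exact step 7 (by simp) (by decide) (by decide) h (hκ 7 (by simp) (by decide) (by decide))

end Summit.KontsevichZagierPeriods.Zeta5Search.WedgeDictionary
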